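import Summits.ResolutionOfSingularities.ResolutionOfSingularities.Theorems.PAlterationPicoverLiftToNormalizationIn
import Summits.ResolutionOfSingularities.ResolutionOfSingularities.Theorems.PAlterationPicoverLocalModelOfDegP
import Summits.ResolutionOfSingularities.ResolutionOfSingularities.Theorems.PAlterationPicoverDegPOfPicover

/-!
# Crux `Picover` (stmt-ResolutionOfSingularities-0554): the local model IS the residue on
# affine bases — `PicoverLocalModel ⟺ affine degree-p residue`

Route `ResolutionOfSingularities/pAlteration`, crux
`Summit.ResolutionOfSingularities.ResolutionOfSingularities.Theses.PAlteration.Picover`, residue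
programme of the line `degree-p-tower` (lead c1).

Lead 0 reduced the crux to its RESIDUE (`stub_picoverDegP`, equivalent to the crux:
`IffDegP.picover_iff_picoverDegP`): for `W` regular integral separated of finite type over `k`
(`char k = p`) and `L ⊇ K(W)` purely inseparable of degree `p`, the normalization `W^L` has a
resolution; and proved residue ⟹ rank-5 item `PicoverLocalModel`
(`LocalModelOfDegP.picoverLocalModel_of_picoverDegP`) — by a proof that only ever applies the
residue to AFFINE `W = Spec R`.

**This file** proves the converse on affine bases and packages the equivalence
(`picoverLocalModel_iff_affineDegP`, registered sub-goal):

> `PicoverLocalModel ⟺` (AFFINE RESIDUE) for every prime `p`, field `k` of characteristic `p`,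
> domain `R` (a `CommRingCat`) finitely generated and regular over `k`, and purely inseparable
> `L ⊇ K(Spec R)` of degree `p`, `normalizationIn (Spec R) L` has a resolution.

So the rank-5 crux (stmt-0557) and the rank-2 crux (stmt-0554 ⟺ residue) differ EXACTLY by
"affine `W` → separated `W`": the Zariski patching of resolutions of the normalizations `W^L`
over an affine cover of a regular `W` (resolutions do not glue in general; cf. the crux
`Valuative.PatchingRel`). `affineDegP_of_picover` records Picover ⟹ affine residue.

**Proof of ⟹.** `L/K`, `K = Frac R`, purely inseparable of prime degree `p` is generated by any
`y ∉ K`, and `y^p ∈ K` (`exists_generator_pow_eq`); clearing denominators, `y^p = a ∈ R`. The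
local model `X_a = Spec Q`, `Q = (R[T]/(T^p - a))_red` (a domain, finite over `R`, tree
`LocalModelOfDegP`) has a resolution by `PicoverLocalModel`; `T ↦ y` gives an injective ring map
`Q → L` (its kernel is the nilradical: `s ↦ 0 ⇒ s^p ∈ R ↦ 0 ⇒ s^p = 0`) whose extension
`K(X_a) = Frac Q → L` is onto (`L = K(y)`); so `W^L` has a resolution by the lifting lemma
`LiftToNormalizationIn.hasResolution_normalizationIn_of_hasResolution` (this seat), packaged as
`hasResolution_normalizationIn_of_monogenic_cover`.
**Proof of ⟸.** Verbatim the landed `LocalModelOfDegP.hasResolution_Spec_of_pow_eq` /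
`picoverLocalModel_of_picoverDegP` with the residue hypothesis restricted to `Spec R`.

Design note: the affine base is a `CommRingCat` (not `Spec (.of R)` for a type `R`) so that
Mathlib's instance `Algebra R (Spec R).functionField` is found.

Sources: M. Temkin, *Inseparable local uniformization*, J. Algebra 373 (2013), Rem. 1.3.5
(ii)–(iii) (the local model `t^p = a`); folklore algebra. Mathlib: `AdjoinRoot.lift`,
`IsFractionRing.lift`, `IsLocalization.ringHom_ext`, `AlgHom.fieldRange`. No new definitions.
-/

noncomputable section

set_option linter.dupNamespace false -- mandated namespace of this single-conjunct summit

open CategoryTheory AlgebraicGeometry TopologicalSpace Polynomial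
open Literature.AlgebraicGeometry.Resolution Literature.AlgebraicGeometry.Motives
open Summit.ResolutionOfSingularities.ResolutionOfSingularities.Theorems.Picover

namespace Summit.ResolutionOfSingularities.ResolutionOfSingularities.Theorems.Picover.AffineDegP

/-! ## Field theory: a purely inseparable extension of prime degree is generated by a `p`-th root -/

/-- **A purely inseparable extension `L/K` of prime degree `p = char K` is `K(y)` with
`y ^ p ∈ K`**: any `y ∉ K` generates (`[K(y) : K]` divides the prime `p` and is not `1`), and
`y ^ p ∈ K` (landed `DegPOfPicover.exists_pow_eq_algebraMap`). [folklore] -/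
theorem exists_generator_pow_eq {K L : Type*} [Field K] [Field L] [Algebra K L] {p : ℕ}
    (hp : p.Prime) [CharP K p] [IsPurelyInseparable K L] (hdeg : Module.finrank K L = p) :
    ∃ y : L, IntermediateField.adjoin K {y} = ⊤ ∧ ∃ c : K, y ^ p = algebraMap K L c := by
  haveI : FiniteDimensional K L := Module.finite_of_finrank_pos (by rw [hdeg]; exact hp.pos)
  haveI : ExpChar K p := ExpChar.prime hp
  -- some `y ∉ K`
  have hns : ¬ Function.Surjective (algebraMap K L) := fun hs =>
    hp.one_lt.ne' (hdeg.symm.trans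
      (Algebra.finrank_eq_one_iff_bijective_algebraMap.mpr ⟨(algebraMap K L).injective, hs⟩))
  obtain ⟨y, hy⟩ := not_forall.mp hns
  refine ⟨y, ?_, DegPOfPicover.exists_pow_eq_algebraMap hp hdeg y⟩
  -- `[K(y) : K]` divides `p` and is not `1`, hence is `p = [L : K]`
  have hdvd : Module.finrank K (IntermediateField.adjoin K {y}) ∣ p := by
    rw [← hdeg]
    exact ⟨_, (Module.finrank_mul_finrank K (IntermediateField.adjoin K {y}) L).symm⟩
  rcases (Nat.dvd_prime hp).mp hdvd with h1 | hP
  · exfalso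
    exact hy (IntermediateField.mem_bot.mp
      (IntermediateField.finrank_adjoin_simple_eq_one_iff.mp h1))
  · exact IntermediateField.eq_of_le_of_finrank_eq le_top
      (by rw [hP, IntermediateField.finrank_top', hdeg])

/-! ## Monogenic finite covers `Spec Q → Spec R` mapping to `L` -/

/-- **Resolving `(Spec R)^L` through a finite cover mapping onto `L`.** Let `R → Q` be an
injective finite map of domains, `Spec R` locally of finite type over a field `k`, `L ⊇ K(Spec R)`
finite, and `θ : Q → L` an injective ring map over `R` such that `L = K(Spec R)(θ t)` for some
`t ∈ Q`. If `Spec Q` has a resolution then so has `normalizationIn (Spec R) L`: the extension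
`K(Spec Q) = Frac Q → L` of `θ` lies over `K(Spec R) → L` and is onto, so the lifting lemma
`LiftToNormalizationIn.hasResolution_normalizationIn_of_hasResolution` applies. [folklore] -/
theorem hasResolution_normalizationIn_of_monogenic_cover {k : Type} [Field k]
    {R Q : CommRingCat.{0}} [IsDomain R] [IsDomain Q] (f : Spec R ⟶ Spec (.of k))
    [LocallyOfFiniteType f] (φ : R ⟶ Q) [IsFinite (Spec.map φ)] (hφ : Function.Injective φ.hom)
    (L : Type) [Field L] [Algebra (Spec R).functionField L]
    [FiniteDimensional (Spec R).functionField L] (θ : Q →+* L) (hθ : Function.Injective θ)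
    (hθR : θ.comp φ.hom =
      (algebraMap (Spec R).functionField L).comp (algebraMap R (Spec R).functionField))
    {t : Q} (hgen : IntermediateField.adjoin (Spec R).functionField {θ t} = ⊤)
    (hres : Scheme.HasResolution (Spec Q)) :
    Scheme.HasResolution (normalizationIn (Spec R) L) := by
  haveI : IsDominant (Spec.map φ) := RatFn.isDominant_SpecMap_of_injective φ hφ
  -- `ψ : K(Spec Q) = Frac Q → L` extends `θ` …
  set ψ : (Spec Q).functionField →+* L := IsFractionRing.lift hθ with hψdef
  -- … lies over `K(Spec R) → L` (check on `R`, `K(Spec R) = Frac R`) …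
  have hψ : ψ.comp (RatFn.functionFieldMap (Spec.map φ)) =
      algebraMap (Spec R).functionField L := by
    refine IsLocalization.ringHom_ext (nonZeroDivisors R) (RingHom.ext fun r => ?_)
    rw [RingHom.comp_apply, RingHom.comp_apply, RatFn.functionFieldMap_SpecMap φ r, hψdef,
      IsFractionRing.lift_algebraMap]
    exact RingHom.congr_fun hθR r
  -- … and is onto: its image is an intermediate field containing the generator `θ t`
  have hψt : ψ (algebraMap Q _ t) = θ t := by rw [hψdef, IsFractionRing.lift_algebraMap]
  have hψs : Function.Surjective ψ := by
    let ψ' : FunctionFieldOver (Spec.map φ) →ₐ[(Spec R).functionField] L :=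
      { ψ.comp (FunctionFieldOver.of (Spec.map φ)).symm.toRingHom with
        commutes' := fun h => by
          change ψ ((FunctionFieldOver.of (Spec.map φ)).symm
            (algebraMap (Spec R).functionField (FunctionFieldOver (Spec.map φ)) h)) = _
          rw [FunctionFieldOver.algebraMap_apply, RingEquiv.symm_apply_apply, ← hψ]
          rfl }
    have htop : ψ'.fieldRange = ⊤ := by
      rw [eq_top_iff, ← hgen, IntermediateField.adjoin_simple_le_iff, AlgHom.mem_fieldRange]
      exact ⟨FunctionFieldOver.of (Spec.map φ) (algebraMap Q _ t), hψt⟩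
    intro z
    have hz : z ∈ ψ'.fieldRange := by rw [htop]; trivial
    obtain ⟨x, hx⟩ := AlgHom.mem_fieldRange.mp hz
    exact ⟨(FunctionFieldOver.of (Spec.map φ)).symm x, hx⟩
  exact LiftToNormalizationIn.hasResolution_normalizationIn_of_hasResolution (Spec R) f L
    (Spec Q) (Spec.map φ) ψ hψ hψs hres

/-! ## `PicoverLocalModel ⟹` the residue on affine bases -/

/-- **The local model gives the residue on affine bases.** Assume `PicoverLocalModel`. Let `k`
be a field of characteristic `p`, `R` a domain, finitely generated and regular over `k`, and
`L ⊇ K(Spec R)` purely inseparable of degree `p`. Then `normalizationIn (Spec R) L` has a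
resolution: write `L = K(y)` with `y^p = a ∈ R` (clear denominators), resolve the local model
`Spec (R[T]/(T^p - a))_red` by `PicoverLocalModel`, map it injectively to `L` by `T ↦ y` and
conclude by `hasResolution_normalizationIn_of_monogenic_cover`. [cite: Temkin2013, Rem. 1.3.5 (ii)] -/
theorem affineDegP_of_picoverLocalModel
    (hLM : Summit.ResolutionOfSingularities.ResolutionOfSingularities.Theses.PAlteration.PicoverLocalModel) :
    ∀ (p : ℕ), p.Prime → ∀ (k : Type) [Field k] [CharP k p] (R : CommRingCat.{0}) [IsDomain R]
      [Algebra k R], Algebra.FiniteType k R → IsRegularRing R → ∀ (L : Type) [Field L]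
      [Algebra (Spec R).functionField L],
      IsPurelyInseparable (Spec R).functionField L →
      Module.finrank (Spec R).functionField L = p →
      Scheme.HasResolution (normalizationIn (Spec R) L) := by
  intro p hp k _ _ R _ _ hft hreg L _ _ hpi hdeg
  haveI : Fact p.Prime := ⟨hp⟩
  haveI := hft
  have hRK : Function.Injective (algebraMap R (Spec R).functionField) :=
    IsFractionRing.injective R (Spec R).functionField
  haveI : CharP R p := charP_of_injective_algebraMap (algebraMap k R).injective p
  haveI : CharP (Spec R).functionField p := charP_of_injective_algebraMap hRK p
  haveI : FiniteDimensional (Spec R).functionField L :=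
    Module.finite_of_finrank_pos (by rw [hdeg]; exact hp.pos)
  -- `L = K(y)`, `y ^ p = c ∈ K`
  obtain ⟨y, hgen, c, hyc⟩ := exists_generator_pow_eq hp hdeg
  -- clear denominators: `c = a / b`, `y' = b y`, `y' ^ p = b ^ (p-1) a =: a'`
  obtain ⟨a, b, hb, hc⟩ := IsFractionRing.div_surjective (A := R) c
  have hb0 : algebraMap R (Spec R).functionField b ≠ 0 :=
    fun h0 => nonZeroDivisors.ne_zero hb (hRK (by rw [h0, map_zero]))
  obtain ⟨m, hm⟩ : ∃ m : ℕ, p = m + 1 := ⟨p - 1, (Nat.succ_pred_eq_of_pos hp.pos).symm⟩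
  set a' : R := b ^ m * a with ha'
  set y' : L := algebraMap (Spec R).functionField L (algebraMap R (Spec R).functionField b) * y
    with hy'def
  -- the ring map `i : R → K → L`
  set i : R →+* L := (algebraMap (Spec R).functionField L).comp
    (algebraMap R (Spec R).functionField) with hi
  have hiinj : Function.Injective i := (algebraMap (Spec R).functionField L).injective.comp hRK
  have hy' : y' ^ p = i a' := by
    have hK : algebraMap R (Spec R).functionField b ^ p * c =
        algebraMap R (Spec R).functionField a' := by
      rw [← hc, ha', map_mul, map_pow, hm, pow_succ, mul_assoc, mul_div_cancel₀ _ hb0]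
    rw [hy'def, mul_pow, hyc, ← map_pow, ← map_mul, hK]
    rfl
  have hgen' : IntermediateField.adjoin (Spec R).functionField {y'} = ⊤ := by
    rw [eq_top_iff, ← hgen, IntermediateField.adjoin_simple_le_iff]
    have hb0' : algebraMap (Spec R).functionField L (algebraMap R (Spec R).functionField b) ≠ 0 :=
      fun h0 => hb0 ((algebraMap (Spec R).functionField L).injective (by rw [h0, map_zero]))
    have hyy' : y = (algebraMap (Spec R).functionField L
        (algebraMap R (Spec R).functionField b))⁻¹ * y' := by
      rw [hy'def, ← mul_assoc, inv_mul_cancel₀ hb0', one_mul]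
    rw [hyy']
    exact mul_mem (inv_mem (IntermediateField.algebraMap_mem _ _))
      (IntermediateField.mem_adjoin_simple_self _ _)
  -- the local model `Q = (R[T]/(T^p - a'))_red`: a domain, finite over `R`, resolved by `hLM`
  have hinjS : Function.Injective (algebraMap R (AdjoinRoot ((X : R[X]) ^ p - C a'))) := by
    rw [AdjoinRoot.algebraMap_eq]
    exact AdjoinRoot.of.injective_of_degree_ne_zero
      (by rw [degree_X_pow_sub_C hp.pos]; exact_mod_cast hp.ne_zero)
  haveI : Module.Finite R (AdjoinRoot ((X : R[X]) ^ p - C a')) :=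
    (AdjoinRoot.powerBasis' (monic_X_pow_sub_C a' hp.ne_zero)).finite
  haveI : Module.Finite R
      (AdjoinRoot ((X : R[X]) ^ p - C a') ⧸ nilradical (AdjoinRoot ((X : R[X]) ^ p - C a'))) :=
    Module.Finite.trans (AdjoinRoot ((X : R[X]) ^ p - C a')) _
  haveI := LocalModelOfDegP.isPrime_nilradical_adjoinRoot a' hp
  haveI : IsDomain
      (AdjoinRoot ((X : R[X]) ^ p - C a') ⧸ nilradical (AdjoinRoot ((X : R[X]) ^ p - C a'))) :=
    Ideal.Quotient.isDomain _
  have hresQ : Scheme.HasResolution (Spec (.of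
      (AdjoinRoot ((X : R[X]) ^ p - C a') ⧸ nilradical (AdjoinRoot ((X : R[X]) ^ p - C a'))))) :=
    hLM p hp k R hft hreg a'
  have hRQ : Function.Injective (algebraMap R
      (AdjoinRoot ((X : R[X]) ^ p - C a') ⧸ nilradical (AdjoinRoot ((X : R[X]) ^ p - C a')))) :=
    LocalModelOfDegP.algebraMap_quotient_nilradical_injective hinjS
  -- `θ : Q → L`, `T ↦ y'`, injective (its kernel is the nilradical)
  have hroot' : ((X : R[X]) ^ p - C a').eval₂ i y' = 0 := by
    rw [eval₂_sub, eval₂_X_pow, eval₂_C, hy', sub_self]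
  set θ₀ : AdjoinRoot ((X : R[X]) ^ p - C a') →+* L := AdjoinRoot.lift i y' hroot' with hθ₀
  have hθ₀nil : ∀ s ∈ nilradical (AdjoinRoot ((X : R[X]) ^ p - C a')), θ₀ s = 0 :=
    fun s hs => ((mem_nilradical.mp hs).map θ₀).eq_zero
  set θ : AdjoinRoot ((X : R[X]) ^ p - C a') ⧸ nilradical (AdjoinRoot ((X : R[X]) ^ p - C a'))
    →+* L := Ideal.Quotient.lift _ θ₀ hθ₀nil with hθ
  have hθinj : Function.Injective θ := by
    rw [injective_iff_map_eq_zero]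
    intro q hq
    obtain ⟨s, rfl⟩ := Ideal.Quotient.mk_surjective q
    rw [hθ, Ideal.Quotient.lift_mk] at hq
    obtain ⟨c', hc'⟩ := LocalModelOfDegP.exists_pow_eq_of a' hp s
    have h0 : i c' = 0 := by
      rw [← AdjoinRoot.lift_of (f := (X : R[X]) ^ p - C a') hroot', ← hc', map_pow, ← hθ₀, hq,
        zero_pow hp.ne_zero]
    obtain rfl : c' = 0 := hiinj (by rw [h0, map_zero])
    exact Ideal.Quotient.eq_zero_iff_mem.mpr (mem_nilradical.mpr ⟨p, by rw [hc', map_zero]⟩)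
  have hθt : θ (Ideal.Quotient.mk _ (AdjoinRoot.root _)) = y' := by
    rw [hθ, Ideal.Quotient.lift_mk, hθ₀, AdjoinRoot.lift_root]
  have hθR : θ.comp (algebraMap R _) = i := by
    refine RingHom.ext fun r => ?_
    change θ (Ideal.Quotient.mk _ (algebraMap R (AdjoinRoot ((X : R[X]) ^ p - C a')) r)) = i r
    rw [hθ, Ideal.Quotient.lift_mk, hθ₀, AdjoinRoot.algebraMap_eq, AdjoinRoot.lift_of]
  -- the finite cover `Spec Q → Spec R` and the structure morphism `Spec R → Spec k`
  set φ : R ⟶ CommRingCat.of (AdjoinRoot ((X : R[X]) ^ p - C a') ⧸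
      nilradical (AdjoinRoot ((X : R[X]) ^ p - C a'))) := CommRingCat.ofHom (algebraMap R _)
    with hφ
  haveI : IsFinite (Spec.map φ) := by
    rw [hφ, IsFinite.SpecMap_iff, CommRingCat.hom_ofHom]
    exact RingHom.finite_algebraMap.mpr inferInstance
  haveI : LocallyOfFiniteType (Spec.map (CommRingCat.ofHom (algebraMap k R))) := by
    rw [HasRingHomProperty.Spec_iff (P := @LocallyOfFiniteType), CommRingCat.hom_ofHom]
    exact RingHom.finiteType_algebraMap.mpr hft
  refine hasResolution_normalizationIn_of_monogenic_cover
    (Spec.map (CommRingCat.ofHom (algebraMap k R))) φ hRQ L θ hθinj hθR ?_ hresQ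
    (t := Ideal.Quotient.mk _ (AdjoinRoot.root _))
  rw [hθt]
  exact hgen'

/-! ## The residue on affine bases `⟹ PicoverLocalModel` -/

/-- **Resolution of `Spec R[t]`, `t^p = a ∈ R`, from the residue on `Spec R`** — the landed
`LocalModelOfDegP.hasResolution_Spec_of_pow_eq` with its residue hypothesis restricted to the
affine base `Spec R` (same proof: `K(Spec Q)/K(Spec R)` is generated by `t`, purely inseparable
of degree `1` — base case — or `p` — the affine residue —, and the finite birational comparison
`(Spec R)^{K(Spec Q)} → Spec Q` transfers the resolution). [cite: Temkin2013, Rem. 1.3.5 (ii)] -/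
theorem hasResolution_Spec_of_pow_eq_of_affineDegP {p : ℕ} (hp : p.Prime) (k : Type) [Field k]
    [CharP k p] {R Q : CommRingCat.{0}} [IsDomain R] [IsDomain Q] [CharP R p]
    (f : Spec R ⟶ Spec (.of k)) [LocallyOfFiniteType f] (hreg : Scheme.IsRegular (Spec R))
    (hAff : ∀ (L : Type) [Field L] [Algebra (Spec R).functionField L],
      IsPurelyInseparable (Spec R).functionField L →
      Module.finrank (Spec R).functionField L = p →
      Scheme.HasResolution (normalizationIn (Spec R) L))
    (φ : R ⟶ Q) [IsFinite (Spec.map φ)] (hφ : Function.Injective φ.hom) {t : Q} {a : R}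
    (ht : t ^ p = φ.hom a) (hgen : ∀ q : Q, ∃ P : R[X], P.eval₂ φ.hom t = q) :
    Scheme.HasResolution (Spec Q) := by
  -- adapted from Theorems/PAlterationPicoverLocalModelOfDegP.lean (`hasResolution_Spec_of_pow_eq`)
  haveI : IsDominant (Spec.map φ) := RatFn.isDominant_SpecMap_of_injective φ hφ
  haveI : CharP (Spec R).functionField p :=
    charP_of_injective_algebraMap (IsFractionRing.injective R (Spec R).functionField) p
  obtain ⟨ψ, hψ⟩ : ∃ ψ : Q →+* FunctionFieldOver (Spec.map φ),
      ∀ q, ψ q = FunctionFieldOver.of (Spec.map φ) (algebraMap Q (Spec Q).functionField q) :=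
    ⟨(FunctionFieldOver.of (Spec.map φ)).toRingHom.comp (algebraMap Q (Spec Q).functionField),
      fun _ => rfl⟩
  have hcomp : ∀ r : R, algebraMap (Spec R).functionField (FunctionFieldOver (Spec.map φ))
      (algebraMap R (Spec R).functionField r) = ψ (φ.hom r) := by
    intro r
    rw [FunctionFieldOver.algebraMap_apply, RatFn.functionFieldMap_SpecMap, hψ]
  have hx : ψ t ^ p = algebraMap (Spec R).functionField (FunctionFieldOver (Spec.map φ))
      (algebraMap R (Spec R).functionField a) := by
    rw [hcomp, ← map_pow, ht]
  have hmem : ∀ q : Q, ψ q ∈ IntermediateField.adjoin (Spec R).functionField {ψ t} := by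
    intro q
    obtain ⟨P, rfl⟩ := hgen q
    have hc : ψ.comp φ.hom = (algebraMap (Spec R).functionField
        (FunctionFieldOver (Spec.map φ))).comp (algebraMap R (Spec R).functionField) :=
      RingHom.ext fun r => (hcomp r).symm
    rw [hom_eval₂, hc, ← eval₂_map, ← aeval_def]
    exact IntermediateField.algebra_adjoin_le_adjoin _ _ (aeval_mem_adjoin_singleton _ _)
  have hgen' : IntermediateField.adjoin (Spec R).functionField {ψ t} = ⊤ := by
    rw [eq_top_iff]
    rintro y -
    obtain ⟨u, v, -, rfl⟩ :=
      IsFractionRing.div_surjective (A := Q) (show (Spec Q).functionField from y)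
    change FunctionFieldOver.of (Spec.map φ)
      (algebraMap Q (Spec Q).functionField u / algebraMap Q (Spec Q).functionField v) ∈ _
    rw [map_div₀, ← hψ, ← hψ]
    exact div_mem (hmem u) (hmem v)
  obtain ⟨hpi, hrank⟩ := LocalModelOfDegP.isPurelyInseparable_and_finrank_of_pow_mem hp hx hgen'
  have hK := FunctionFieldNormalizationIn.stub_functionField_normalizationIn (Spec R)
    (FunctionFieldOver (Spec.map φ))
  have hN : Scheme.HasResolution (normalizationIn (Spec R) (FunctionFieldOver (Spec.map φ))) := by
    rcases hrank with h1 | hP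
    · exact BaseCase.stub_baseCase (Spec R) (FunctionFieldOver (Spec.map φ)) hK hreg h1
    · exact hAff (FunctionFieldOver (Spec.map φ)) hpi hP
  exact OfNormalizationIn.stub_ofNormalizationIn k (Spec Q) (Spec R) f (Spec.map φ) hK hN

/-- **The residue on affine bases gives the local model** — the landed
`LocalModelOfDegP.picoverLocalModel_of_picoverDegP` with its hypothesis restricted to affine
bases (same proof). [cite: Temkin2013, Rem. 1.3.5 (ii)] -/
theorem picoverLocalModel_of_affineDegP
    (hAff : ∀ (p : ℕ), p.Prime → ∀ (k : Type) [Field k] [CharP k p] (R : CommRingCat.{0})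
      [IsDomain R] [Algebra k R], Algebra.FiniteType k R → IsRegularRing R → ∀ (L : Type) [Field L]
      [Algebra (Spec R).functionField L],
      IsPurelyInseparable (Spec R).functionField L →
      Module.finrank (Spec R).functionField L = p →
      Scheme.HasResolution (normalizationIn (Spec R) L)) :
    Summit.ResolutionOfSingularities.ResolutionOfSingularities.Theses.PAlteration.PicoverLocalModel := by
  -- adapted from Theorems/PAlterationPicoverLocalModelOfDegP.lean (`picoverLocalModel_of_picoverDegP`)
  intro p hp k _ _ R _ _ _ hft hreg a
  haveI : Fact p.Prime := ⟨hp⟩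
  haveI : CharP R p := charP_of_injective_algebraMap (algebraMap k R).injective p
  haveI := hft
  haveI := hreg
  have hinjS : Function.Injective (algebraMap R (AdjoinRoot ((X : R[X]) ^ p - C a))) := by
    rw [AdjoinRoot.algebraMap_eq]
    exact AdjoinRoot.of.injective_of_degree_ne_zero
      (by rw [degree_X_pow_sub_C hp.pos]; exact_mod_cast hp.ne_zero)
  haveI : Module.Finite R (AdjoinRoot ((X : R[X]) ^ p - C a)) :=
    (AdjoinRoot.powerBasis' (monic_X_pow_sub_C a hp.ne_zero)).finite
  haveI : Module.Finite R
      (AdjoinRoot ((X : R[X]) ^ p - C a) ⧸ nilradical (AdjoinRoot ((X : R[X]) ^ p - C a))) :=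
    Module.Finite.trans (AdjoinRoot ((X : R[X]) ^ p - C a)) _
  haveI := LocalModelOfDegP.isPrime_nilradical_adjoinRoot a hp
  haveI : IsDomain
      (AdjoinRoot ((X : R[X]) ^ p - C a) ⧸ nilradical (AdjoinRoot ((X : R[X]) ^ p - C a))) :=
    Ideal.Quotient.isDomain _
  haveI : LocallyOfFiniteType (Spec.map (CommRingCat.ofHom (algebraMap k R))) := by
    rw [HasRingHomProperty.Spec_iff (P := @LocallyOfFiniteType), CommRingCat.hom_ofHom]
    exact RingHom.finiteType_algebraMap.mpr hft
  haveI : IsFinite (Spec.map (CommRingCat.ofHom (algebraMap R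
      (AdjoinRoot ((X : R[X]) ^ p - C a) ⧸ nilradical (AdjoinRoot ((X : R[X]) ^ p - C a)))))) := by
    rw [IsFinite.SpecMap_iff, CommRingCat.hom_ofHom]
    exact RingHom.finite_algebraMap.mpr inferInstance
  have hroot : AdjoinRoot.root ((X : R[X]) ^ p - C a) ^ p = AdjoinRoot.of _ a := by
    have h := AdjoinRoot.eval₂_root ((X : R[X]) ^ p - C a)
    rwa [eval₂_sub, eval₂_X_pow, eval₂_C, sub_eq_zero] at h
  refine hasResolution_Spec_of_pow_eq_of_affineDegP hp k
    (Spec.map (CommRingCat.ofHom (algebraMap k R))) (Scheme.isRegular_Spec (.of R))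
    (hAff p hp k (CommRingCat.of R) hft hreg) (CommRingCat.ofHom (algebraMap R _))
    (LocalModelOfDegP.algebraMap_quotient_nilradical_injective hinjS)
    (t := Ideal.Quotient.mk _ (AdjoinRoot.root _)) (a := a) ?_ ?_
  · change Ideal.Quotient.mk _ (AdjoinRoot.root _) ^ p =
      Ideal.Quotient.mk _ (algebraMap R (AdjoinRoot ((X : R[X]) ^ p - C a)) a)
    rw [← map_pow, hroot, AdjoinRoot.algebraMap_eq]
  · intro q
    obtain ⟨s, rfl⟩ := Ideal.Quotient.mk_surjective q
    obtain ⟨P, rfl⟩ := AdjoinRoot.mk_surjective s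
    refine ⟨P, ?_⟩
    change P.eval₂ ((Ideal.Quotient.mk _).comp (algebraMap R (AdjoinRoot ((X : R[X]) ^ p - C a))))
      (Ideal.Quotient.mk _ (AdjoinRoot.root _)) = _
    rw [← hom_eval₂, ← aeval_def, AdjoinRoot.aeval_eq]

/-! ## The equivalence and the crux -/

/-- **`PicoverLocalModel ⟺` the degree-`p` residue on affine bases** (registered sub-goal of the
crux `Picover`): the rank-5 item of route pAlteration is EXACTLY the residue of the rank-2 crux
restricted to affine regular bases `Spec R`; the two cruxes differ by the Zariski patching of the
resolutions of the `W^L` over an affine cover of a regular separated `W`.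
[cite: Temkin2013, Rem. 1.3.5 (ii)] -/
theorem picoverLocalModel_iff_affineDegP : Summit.ResolutionOfSingularities.ResolutionOfSingularities.Theses.PAlteration.PicoverLocalModel ↔ ∀ (p : ℕ), p.Prime → ∀ (k : Type) [Field k] [CharP k p] (R : CommRingCat.{0}) [IsDomain R] [Algebra k R], Algebra.FiniteType k R → IsRegularRing R → ∀ (L : Type) [Field L] [Algebra (Spec R).functionField L], IsPurelyInseparable (Spec R).functionField L → Module.finrank (Spec R).functionField L = p → Scheme.HasResolution (normalizationIn (Spec R) L) :=
  ⟨affineDegP_of_picoverLocalModel, picoverLocalModel_of_affineDegP⟩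

/-- **The crux gives the residue on affine bases** (through the landed `Picover ⟹ residue`,
`DegPOfPicover.picoverDegP_of_picover`, at `W = Spec R`). The converse implication "affine
residue ⟹ Picover" is precisely what is open between rank 5 and rank 2 (patching). [folklore] -/
theorem affineDegP_of_picover
    (hPic : Summit.ResolutionOfSingularities.ResolutionOfSingularities.Theses.PAlteration.Picover) :
    ∀ (p : ℕ), p.Prime → ∀ (k : Type) [Field k] [CharP k p] (R : CommRingCat.{0}) [IsDomain R]
      [Algebra k R], Algebra.FiniteType k R → IsRegularRing R → ∀ (L : Type) [Field L]
      [Algebra (Spec R).functionField L],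
      IsPurelyInseparable (Spec R).functionField L →
      Module.finrank (Spec R).functionField L = p →
      Scheme.HasResolution (normalizationIn (Spec R) L) := by
  intro p hp k _ _ R _ _ hft hreg L _ _ hpi hdeg
  haveI := hreg
  haveI : LocallyOfFiniteType (Spec.map (CommRingCat.ofHom (algebraMap k R))) := by
    rw [HasRingHomProperty.Spec_iff (P := @LocallyOfFiniteType), CommRingCat.hom_ofHom]
    exact RingHom.finiteType_algebraMap.mpr hft
  exact DegPOfPicover.picoverDegP_of_picover hPic p hp k (Spec R)
    (Spec.map (CommRingCat.ofHom (algebraMap k R))) L inferInstance inferInstance inferInstance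
    (Scheme.isRegular_Spec R) hpi hdeg

end Summit.ResolutionOfSingularities.ResolutionOfSingularities.Theorems.Picover.AffineDegP

end
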